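import Mathlib
import HarnessLib
import Summits.HubbardSuperconductivity.HubbardSuperconductivity.Theorems.KLProgrammeKLRegimeEngineSymInterpSymmetrise
import Summits.HubbardSuperconductivity.HubbardSuperconductivity.Theorems.KLProgrammeKLRegimeSplitSymInterpExact
import Summits.HubbardSuperconductivity.HubbardSuperconductivity.Theorems.KLProgrammeKLRegimeSplitSymInterpProduct

/-!
# K3 gen-8-FLOW (stmt 20437, stub (C), «(C)-B-REP» sup route S-d, generic layer 2): DRESSED lattice data `Re(G(k)·H(k))` under the symmetrised
# interpolant ARE the samples of the `D₄`-symmetric continuum symbol `q ↦ Σ_x Re(g(q)·Ȟ(x))·h_{|x̃₀|,|x̃₁|}(q)`; the near harmonics in c4a-1's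
# `(B, c)` cosine currency

Cell gate-hubbard-kl, seat p2 g14 (assembly `…EngineFrameShiftDressingSup`).  The corrected (B) door's tree/dressing data are `f(k) = Re(G(k)·H(k))` with
`G = g∘p` the lattice samples of a smooth `2π`-periodic `D₄`-symmetric symbol (`g ∈ {d, J₁-, J₂-factors}`) and `H` an ARBITRARY lattice two-leg factor.
Writing `H(k) = Σ_x Ȟ(x)·conj χ_k(x)` (`Ȟ = 𝔉⁻¹H`), each site term is a sampled smooth function times a character; its eightfold `B₂`-average — which is
all the interpolant sees (`eval_symInterp_avg8`, layer 1) — is `Re(G(k)Ȟ(x))·h_{|x̃₀|,|x̃₁|}(p_k)` because `G` is `B₂`-invariant and the average of the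
eight characters is the symmetrised harmonic (`harmonic_latticeMomentum_eq_re`).  Hence:

* §1 `latticeFactor_eq_sum_conj_torusChar`, `dressed_re_eq_sum`; §2 `avg8_re_mul_conj_torusChar` (eight characters average to `Re z·h_x(p_k)`),
  `avg8_siteDatum`;
* §3 **`eval_symInterp_dressed_eq_harmonics`** — `(symInterp L Re(G·H)).eval p = (symInterp L (k ↦ Σ_x Re(G(k)Ȟ(x))·h_x(p_k))).eval p` for every
  `B₂`-invariant `G` and EVERY `H` (no symmetry of `H`);
* §4 **`exists_trigPoly_of_near_harmonics`** — the NEAR harmonics (`4|x̃ᵢ| ≤ L`) with real weights `a` are a cosine polynomial in c4a-1's currency: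
  `∃ B c`, `4|yᵢ| ≤ L` on `B`, `Σ_{x near} a(x)·h_x(q) = Σ_{y∈B} c_y cos(y·q)`, and `Σ_{y∈B}|c_y|(1+|y₀|+|y₁|)ʲ ≤ Σ_{x near}|a(x)|(1+|x̃₀|+|x̃₁|)ʲ` for all `j`
  (each harmonic is four integer-frequency cosines, `harmonic_natAbs_eq_cos_four`; coefficients aggregated over coincident frequencies).

Proofs only; no definitions; nothing about the model is asserted.  References: BGM 2006 §2.3 (2.17) [cite: BenfattoGiulianiMastropietro2006]; Boyd 2001 §4.5
[cite: Boyd2001].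
-/

noncomputable section

namespace Summit.HubbardSuperconductivity.HubbardSuperconductivity.Theorems.EngineV8

set_option linter.dupNamespace false -- summit = problem name (single-conjunct summit), D-0017

open Real Finset Literature.MathematicalPhysics.QuantumLattice Literature.Probability.LatticeModels
open Summit.HubbardSuperconductivity.HubbardSuperconductivity.Theorems.KLRegimeSplit
open scoped ComplexConjugate

variable {L : ℕ} [NeZero L]

/-! ## §1 The lattice factor through its position-space coefficients -/

/-- Fourier inversion: `H(k) = Σ_x 𝔉⁻¹H(x)·conj χ_k(x)`. -/
theorem latticeFactor_eq_sum_conj_torusChar (H : TorusSite 2 L → ℂ) (k : TorusSite 2 L) :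
    H k = ∑ x : TorusSite 2 L, torusFourierInv H x * conj (torusChar k x) := by
  have h := congrFun (torusFourier_torusFourierInv_holds (d := 2) (L := L) H) k
  rw [torusFourier_eq_sum_torusChar] at h
  exact h.symm

/-- The dressed datum as a site sum: `Re(G(k)H(k)) = Σ_x Re(G(k)·𝔉⁻¹H(x)·conj χ_k(x))`. -/
theorem dressed_re_eq_sum (G H : TorusSite 2 L → ℂ) (k : TorusSite 2 L) :
    (G k * H k).re = ∑ x : TorusSite 2 L, (G k * torusFourierInv H x * conj (torusChar k x)).re := by
  rw [latticeFactor_eq_sum_conj_torusChar H k, mul_sum, Complex.re_sum]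
  simp_rw [mul_assoc]

/-! ## §2 The eightfold character average is the symmetrised harmonic -/

/-- `χ_{(−k₁,k₀)}(x) = χ_k(x₁,−x₀)`. -/
theorem torusChar_rot_left (k x : TorusSite 2 L) : torusChar (![-k 1, k 0] : TorusSite 2 L) x = torusChar k ![x 1, -x 0] := by
  simp only [torusChar, Fin.prod_univ_two, Matrix.cons_val_zero, Matrix.cons_val_one, mul_neg, neg_mul]
  exact mul_comm _ _

/-- `Re(z·conj w) + Re(z·w) = 2·Re z·Re w`. -/
theorem re_mul_conj_add_re_mul (z w : ℂ) : (z * conj w).re + (z * w).re = 2 * (z.re * w.re) := by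
  simp [Complex.mul_re, Complex.conj_re, Complex.conj_im]; ring

/-- **Eight characters average to the harmonic**: for every `z`,
`⅛·Σ_{γ ∈ B₂} Re(z·conj χ_{γk}(x)) = Re z · h_{|x̃₀|,|x̃₁|}(p_k)` (the `B₂`-images in the order of `eval_symInterp_avg8`). -/
theorem avg8_re_mul_conj_torusChar (z : ℂ) (k x : TorusSite 2 L) :
    ((z * conj (torusChar k x)).re + (z * conj (torusChar (-k) x)).re + (z * conj (torusChar (![k 0, -k 1] : TorusSite 2 L) x)).re +
        (z * conj (torusChar (![-k 0, k 1] : TorusSite 2 L) x)).re + (z * conj (torusChar (![k 1, k 0] : TorusSite 2 L) x)).re +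
        (z * conj (torusChar (![-k 1, -k 0] : TorusSite 2 L) x)).re + (z * conj (torusChar (![-k 1, k 0] : TorusSite 2 L) x)).re +
        (z * conj (torusChar (![k 1, -k 0] : TorusSite 2 L) x)).re) / 8 =
      z.re * TrigPolyC4v.harmonic (x 0).valMinAbs.natAbs (x 1).valMinAbs.natAbs (latticeMomentum L k) := by
  -- the four antipodal pairs
  have hneg : ∀ k' : TorusSite 2 L, conj (torusChar (-k') x) = torusChar k' x := fun k' => by
    rw [← torusChar_neg_right_eq_neg_left, torusChar_neg_right, Complex.conj_conj]
  have h2 : (![-k 0, k 1] : TorusSite 2 L) = -(![k 0, -k 1] : TorusSite 2 L) := by ext i; fin_cases i <;> simp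
  have h3 : (![-k 1, -k 0] : TorusSite 2 L) = -(![k 1, k 0] : TorusSite 2 L) := by ext i; fin_cases i <;> simp
  have h4 : (![k 1, -k 0] : TorusSite 2 L) = -(![-k 1, k 0] : TorusSite 2 L) := by ext i; fin_cases i <;> simp
  rw [h2, h3, h4, hneg, hneg, hneg, hneg, ← torusChar_reflect, ← torusChar_swap, torusChar_rot_left, harmonic_latticeMomentum_eq_re]
  have e1 := re_mul_conj_add_re_mul z (torusChar k x)
  have e2 := re_mul_conj_add_re_mul z (torusChar k ![x 0, -x 1])
  have e3 := re_mul_conj_add_re_mul z (torusChar k ![x 1, x 0])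
  have e4 := re_mul_conj_add_re_mul z (torusChar k ![x 1, -x 0])
  linear_combination (e1 + e2 + e3 + e4) / 8

/-- **The eightfold average of one site term of the dressed datum**: for `B₂`-invariant `G`,
`⅛Σ_γ Re(G(γk)·c·conj χ_{γk}(x)) = Re(G(k)·c)·h_{|x̃₀|,|x̃₁|}(p_k)`. -/
theorem avg8_siteDatum (G : TorusSite 2 L → ℂ) (hGn : ∀ k, G (-k) = G k) (hGr : ∀ k, G ![k 0, -k 1] = G k) (hGs : ∀ k, G ![k 1, k 0] = G k)
    (c : ℂ) (x k : TorusSite 2 L) :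
    ((G k * c * conj (torusChar k x)).re + (G (-k) * c * conj (torusChar (-k) x)).re +
        (G ![k 0, -k 1] * c * conj (torusChar (![k 0, -k 1] : TorusSite 2 L) x)).re +
        (G ![-k 0, k 1] * c * conj (torusChar (![-k 0, k 1] : TorusSite 2 L) x)).re +
        (G ![k 1, k 0] * c * conj (torusChar (![k 1, k 0] : TorusSite 2 L) x)).re +
        (G ![-k 1, -k 0] * c * conj (torusChar (![-k 1, -k 0] : TorusSite 2 L) x)).re +
        (G ![-k 1, k 0] * c * conj (torusChar (![-k 1, k 0] : TorusSite 2 L) x)).re +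
        (G ![k 1, -k 0] * c * conj (torusChar (![k 1, -k 0] : TorusSite 2 L) x)).re) / 8 =
      (G k * c).re * TrigPolyC4v.harmonic (x 0).valMinAbs.natAbs (x 1).valMinAbs.natAbs (latticeMomentum L k) := by
  have g2 : G ![-k 0, k 1] = G k := by
    have h : (![-k 0, k 1] : TorusSite 2 L) = -(![k 0, -k 1] : TorusSite 2 L) := by ext i; fin_cases i <;> simp
    rw [h, hGn, hGr]
  have g3 : G ![-k 1, -k 0] = G k := by
    have h : (![-k 1, -k 0] : TorusSite 2 L) = -(![k 1, k 0] : TorusSite 2 L) := by ext i; fin_cases i <;> simp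
    rw [h, hGn, hGs]
  have g4 : G ![-k 1, k 0] = G k := by
    have h := hGs ![k 0, -k 1]
    simp only [Matrix.cons_val_one, Matrix.cons_val_zero] at h
    rw [h, hGr]
  have g5 : G ![k 1, -k 0] = G k := by
    have h := hGr ![k 1, k 0]
    simp only [Matrix.cons_val_one, Matrix.cons_val_zero] at h
    rw [h, hGs]
  rw [hGn, hGr, g2, hGs, g3, g4, g5]
  exact avg8_re_mul_conj_torusChar (G k * c) k x

/-! ## §3 The interpolant of dressed data is the interpolant of sampled symmetric harmonics data -/

/-- **DRESSED DATA UNDER THE SYMMETRISED INTERPOLANT**: for `B₂`-invariant lattice samples `G` and ANY lattice factor `H`,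
`(symInterp L (k ↦ Re(G(k)H(k)))).eval p = (symInterp L (k ↦ Σ_x Re(G(k)·𝔉⁻¹H(x))·h_{|x̃₀|,|x̃₁|}(p_k))).eval p`. -/
theorem eval_symInterp_dressed_eq_harmonics (G H : TorusSite 2 L → ℂ) (hGn : ∀ k, G (-k) = G k) (hGr : ∀ k, G ![k 0, -k 1] = G k)
    (hGs : ∀ k, G ![k 1, k 0] = G k) (p : Fin 2 → ℝ) :
    (symInterp L (fun k => (G k * H k).re)).eval p =
      (symInterp L (fun k => ∑ x : TorusSite 2 L, (G k * torusFourierInv H x).re *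
        TrigPolyC4v.harmonic (x 0).valMinAbs.natAbs (x 1).valMinAbs.natAbs (latticeMomentum L k))).eval p := by
  have hdata : (fun k => (G k * H k).re) = fun k => ∑ x : TorusSite 2 L, (G k * torusFourierInv H x * conj (torusChar k x)).re :=
    funext fun k => dressed_re_eq_sum G H k
  rw [hdata, eval_symInterp_finset_sum L univ (fun x k => (G k * torusFourierInv H x * conj (torusChar k x)).re) p,
    eval_symInterp_finset_sum L univ (fun x k => (G k * torusFourierInv H x).re *
      TrigPolyC4v.harmonic (x 0).valMinAbs.natAbs (x 1).valMinAbs.natAbs (latticeMomentum L k)) p]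
  refine sum_congr rfl fun x _ => ?_
  rw [← eval_symInterp_avg8 (fun k => (G k * torusFourierInv H x * conj (torusChar k x)).re) p]
  congr 2
  funext k
  exact avg8_siteDatum G hGn hGr hGs (torusFourierInv H x) x k

/-! ## §4 The near harmonics as a cosine polynomial in the `(B, c)` currency -/

omit [NeZero L] in
/-- A harmonic with `natAbs` indices is four integer-frequency cosines:
`h_{|a|,|b|}(q) = ¼[cos(aq₀+bq₁) + cos(aq₀−bq₁) + cos(bq₀+aq₁) + cos(bq₀−aq₁)]`. -/
theorem harmonic_natAbs_eq_cos_four (a b : ℤ) (q : Fin 2 → ℝ) :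
    TrigPolyC4v.harmonic a.natAbs b.natAbs q =
      (Real.cos (a * q 0 + b * q 1) + Real.cos (a * q 0 - b * q 1) + Real.cos (b * q 0 + a * q 1) + Real.cos (b * q 0 - a * q 1)) / 4 := by
  unfold TrigPolyC4v.harmonic
  rw [cos_natAbs_mul, cos_natAbs_mul, cos_natAbs_mul, cos_natAbs_mul, Real.cos_add, Real.cos_sub, Real.cos_add, Real.cos_sub]
  ring

/-- **THE NEAR HARMONICS ARE A RESOLVED COSINE POLYNOMIAL** (c4a-1's `(B, c)` currency): for real site weights `a` and the near sites
`{x : 4|x̃ᵢ| ≤ L}`, there are `B ⊂ ℤ²` with `4|yᵢ| ≤ L` on `B` and `c : ℤ² → ℝ` with `Σ_{x near} a(x)·h_{|x̃₀|,|x̃₁|}(q) = Σ_{y∈B} c_y·cos(Σᵢ yᵢqᵢ)` for all `q`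
and `Σ_{y∈B}|c_y|(1+|y₀|+|y₁|)ʲ ≤ Σ_{x near}|a(x)|(1+|x̃₀|+|x̃₁|)ʲ` for every `j`. -/
theorem exists_trigPoly_of_near_harmonics (a : TorusSite 2 L → ℝ) :
    ∃ (B : Finset (Fin 2 → ℤ)) (c : (Fin 2 → ℤ) → ℝ), (∀ y ∈ B, ∀ i, 4 * |y i| ≤ (L : ℤ)) ∧
      (∀ q : Fin 2 → ℝ, ∑ x ∈ univ.filter (fun x : TorusSite 2 L => ∀ i, 4 * |(x i).valMinAbs| ≤ (L : ℤ)),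
          a x * TrigPolyC4v.harmonic (x 0).valMinAbs.natAbs (x 1).valMinAbs.natAbs q =
        ∑ y ∈ B, c y * Real.cos (∑ i : Fin 2, (y i : ℝ) * q i)) ∧
      (∀ j : ℕ, ∑ y ∈ B, |c y| * (1 + |((y 0 : ℤ) : ℝ)| + |((y 1 : ℤ) : ℝ)|) ^ j ≤
        ∑ x ∈ univ.filter (fun x : TorusSite 2 L => ∀ i, 4 * |(x i).valMinAbs| ≤ (L : ℤ)),
          |a x| * (1 + ((x 0).valMinAbs.natAbs : ℝ) + ((x 1).valMinAbs.natAbs : ℝ)) ^ j) := by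
  classical
  set near := univ.filter (fun x : TorusSite 2 L => ∀ i, 4 * |(x i).valMinAbs| ≤ (L : ℤ)) with hnear
  -- the four frequency vectors of the harmonic of `x`
  set v : Fin 4 → TorusSite 2 L → (Fin 2 → ℤ) := ![fun x => ![(x 0).valMinAbs, (x 1).valMinAbs], fun x => ![(x 0).valMinAbs, -(x 1).valMinAbs],
    fun x => ![(x 1).valMinAbs, (x 0).valMinAbs], fun x => ![(x 1).valMinAbs, -(x 0).valMinAbs]] with hv
  set B : Finset (Fin 2 → ℤ) := near.biUnion fun x => univ.image fun e : Fin 4 => v e x with hB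
  set c : (Fin 2 → ℤ) → ℝ := fun y => ∑ x ∈ near, ∑ e : Fin 4, if v e x = y then a x / 4 else 0 with hc
  have hvmem : ∀ x ∈ near, ∀ e : Fin 4, v e x ∈ B := fun x hx e => mem_biUnion.2 ⟨x, hx, mem_image.2 ⟨e, mem_univ _, rfl⟩⟩
  have hvabs : ∀ (x : TorusSite 2 L) (e : Fin 4) (i : Fin 2), |v e x i| = |(x 0).valMinAbs| ∨ |v e x i| = |(x 1).valMinAbs| := by
    intro x e i
    fin_cases e <;> fin_cases i <;> simp [hv]
  have hvw : ∀ (x : TorusSite 2 L) (e : Fin 4), (1 + |((v e x 0 : ℤ) : ℝ)| + |((v e x 1 : ℤ) : ℝ)|) =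
      1 + ((x 0).valMinAbs.natAbs : ℝ) + ((x 1).valMinAbs.natAbs : ℝ) := by
    intro x e
    rw [Nat.cast_natAbs, Nat.cast_natAbs, Int.cast_abs, Int.cast_abs]
    fin_cases e <;> simp [hv] <;> ring
  refine ⟨B, c, fun y hy i => ?_, fun q => ?_, fun j => ?_⟩
  · -- resolved frequencies
    obtain ⟨x, hx, hy⟩ := mem_biUnion.1 hy
    obtain ⟨e, -, rfl⟩ := mem_image.1 hy
    have hx' := (mem_filter.1 hx).2
    rcases hvabs x e i with h | h <;> rw [h]
    · exact hx' 0
    · exact hx' 1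
  · -- the polynomial identity
    have hcos : ∀ x : TorusSite 2 L, a x * TrigPolyC4v.harmonic (x 0).valMinAbs.natAbs (x 1).valMinAbs.natAbs q =
        ∑ e : Fin 4, a x / 4 * Real.cos (∑ i : Fin 2, (v e x i : ℝ) * q i) := by
      intro x
      rw [harmonic_natAbs_eq_cos_four, Fin.sum_univ_four]
      simp only [hv, Fin.sum_univ_two, Matrix.cons_val_zero, Matrix.cons_val_one, Matrix.cons_val, Int.cast_neg]
      ring_nf
    simp_rw [hcos]
    rw [show (∑ y ∈ B, c y * Real.cos (∑ i : Fin 2, (y i : ℝ) * q i)) =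
        ∑ y ∈ B, ∑ x ∈ near, ∑ e : Fin 4, (if v e x = y then a x / 4 * Real.cos (∑ i : Fin 2, (y i : ℝ) * q i) else 0) by
      refine sum_congr rfl fun y _ => ?_
      rw [hc, sum_mul]
      refine sum_congr rfl fun x _ => ?_
      rw [sum_mul]
      refine sum_congr rfl fun e _ => ?_
      split_ifs <;> simp]
    rw [Finset.sum_comm (s := B)]
    refine sum_congr rfl fun x hx => ?_
    rw [Finset.sum_comm (s := B)]
    refine sum_congr rfl fun e _ => ?_
    rw [Finset.sum_ite_eq, if_pos (hvmem x hx e)]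
  · -- the moments
    have hcabs : ∀ y, |c y| ≤ ∑ x ∈ near, ∑ e : Fin 4, if v e x = y then |a x| / 4 else 0 := by
      intro y
      rw [hc]
      refine (abs_sum_le_sum_abs _ _).trans (sum_le_sum fun x _ => (abs_sum_le_sum_abs _ _).trans (sum_le_sum fun e _ => ?_))
      split_ifs
      · rw [abs_div, abs_of_pos (by norm_num : (0 : ℝ) < 4)]
      · rw [abs_zero]
    calc ∑ y ∈ B, |c y| * (1 + |((y 0 : ℤ) : ℝ)| + |((y 1 : ℤ) : ℝ)|) ^ j
        ≤ ∑ y ∈ B, (∑ x ∈ near, ∑ e : Fin 4, if v e x = y then |a x| / 4 else 0) * (1 + |((y 0 : ℤ) : ℝ)| + |((y 1 : ℤ) : ℝ)|) ^ j :=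
          sum_le_sum fun y _ => mul_le_mul_of_nonneg_right (hcabs y) (by positivity)
      _ = ∑ y ∈ B, ∑ x ∈ near, ∑ e : Fin 4, (if v e x = y then |a x| / 4 * (1 + |((y 0 : ℤ) : ℝ)| + |((y 1 : ℤ) : ℝ)|) ^ j else 0) := by
          refine sum_congr rfl fun y _ => ?_
          rw [sum_mul]
          refine sum_congr rfl fun x _ => ?_
          rw [sum_mul]
          refine sum_congr rfl fun e _ => ?_
          split_ifs <;> simp
      _ = ∑ x ∈ near, ∑ e : Fin 4, |a x| / 4 * (1 + |((v e x 0 : ℤ) : ℝ)| + |((v e x 1 : ℤ) : ℝ)|) ^ j := by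
          rw [Finset.sum_comm (s := B)]
          refine sum_congr rfl fun x hx => ?_
          rw [Finset.sum_comm (s := B)]
          refine sum_congr rfl fun e _ => ?_
          rw [Finset.sum_ite_eq, if_pos (hvmem x hx e)]
      _ = ∑ x ∈ near, |a x| * (1 + ((x 0).valMinAbs.natAbs : ℝ) + ((x 1).valMinAbs.natAbs : ℝ)) ^ j := by
          refine sum_congr rfl fun x _ => ?_
          simp_rw [hvw x]
          rw [Fin.sum_univ_four]
          ring

end Summit.HubbardSuperconductivity.HubbardSuperconductivity.Theorems.EngineV8

end
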